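import Literature.Computability.AlgebraicComplexity.SlidingWindowDerivatives
import Literature.Computability.AlgebraicComplexity.ZeroWindowStrings
import HarnessLib

/-!
# Sliding-window polynomial: agreements are zero windows of the XOR string

Topic `Literature/Computability/AlgebraicComplexity`; sequel of `SlidingWindowDerivatives.lean`.
The pair statistics `agr(z, z')` (number of non-site layers where the windows of two strings
agree) that control Kumar–Saraf's `T₂` and `T₃` for the sliding-window witness are, by the
symmetry `z' ↦ z ⊕ z'`, statistics of ONE string: `agr(z, z') = nsZero(z ⊕ z')`, the number of
non-site all-zero windows of the XOR. This file proves that transport and expresses the counts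
through `ZeroWindow.zwin` (`ZeroWindowStrings.lean`):

* `xorV`, `win_xorV`, `agr_eq_nsZero`;
* `sum_Zset_eq_sum_Zset_zero` (`∑_{z' ∈ Zset wv} f(agr z z') = ∑_{u ∈ Zset 0} f(nsZero u)` for
  `z ∈ Zset wv`) and `sum_univ_agr_eq` (`∑_{z'} f(agr z z') = ∑_u f(nsZero u)`);
* `zwin_eq_card` — `zwin t l` counts the positions of all-zero windows;
  `nsZero_add_eq_zwin` (`nsZero u + r = zwin (u)` when all site windows of `u` are zero) and
  `nsZero_le_zwin`.

## References

* M. Kumar, S. Saraf, *On the power of homogeneous depth 4 arithmetic circuits*, SIAM J. Comput.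
  46 (2017) 336–387, §8.5–§9 (the sums `T₂, T₃`).
-/

noncomputable section

namespace Literature.Computability.AlgebraicComplexity

namespace SlidingWindow

open ZeroWindow

variable {n t B r : ℕ}

/-! ### XOR of strings and windows -/

/-- Pointwise XOR of two lists of equal length is all-`false` iff the lists are equal. [folklore] -/
theorem zipWith_xor_eq_replicate_iff : ∀ (a b : List Bool), a.length = b.length →
    (List.zipWith xor a b = List.replicate a.length false ↔ a = b)
  | [], [], _ => by simp
  | [], _ :: _, h => by simp at h
  | _ :: _, [], h => by simp at h
  | x :: a, y :: b, h => by
    have ih := zipWith_xor_eq_replicate_iff a b (by simpa using h)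
    simp only [List.zipWith_cons_cons, List.length_cons, List.replicate_succ, List.cons.injEq, ih]
    constructor
    · rintro ⟨h1, h2⟩; exact ⟨by revert h1; cases x <;> cases y <;> decide, h2⟩
    · rintro ⟨rfl, h2⟩; exact ⟨by cases x <;> rfl, h2⟩

/-- XOR-ing twice with the same list is the identity. [folklore] -/
theorem zipWith_xor_zipWith_xor : ∀ (a b : List Bool), a.length = b.length →
    List.zipWith xor a (List.zipWith xor a b) = b
  | [], [], _ => rfl
  | [], _ :: _, h => by simp at h
  | _ :: _, [], h => by simp at h
  | x :: a, y :: b, h => by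
    rw [List.zipWith_cons_cons, List.zipWith_cons_cons, zipWith_xor_zipWith_xor a b (by simpa using h)]
    cases x <;> cases y <;> rfl

/-- The XOR of two strings. [folklore] -/
def xorV (z z' : List.Vector Bool (n + t)) : List.Vector Bool (n + t) :=
  ⟨List.zipWith xor z.toList z'.toList, by
    rw [List.length_zipWith, z.toList_length, z'.toList_length, min_self]⟩

/-- Unfolding `xorV`. [folklore] -/
@[simp] theorem toList_xorV (z z' : List.Vector Bool (n + t)) :
    (xorV z z').toList = List.zipWith xor z.toList z'.toList := rfl

/-- `xorV z` is an involution. [folklore] -/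
theorem xorV_xorV (z z' : List.Vector Bool (n + t)) : xorV z (xorV z z') = z' := by
  apply List.Vector.eq
  simp only [toList_xorV]
  exact zipWith_xor_zipWith_xor _ _ (by rw [z.toList_length, z'.toList_length])

/-- The all-zero window. [folklore] -/
def zeroWin (t : ℕ) : Win t := ⟨List.replicate (t + 1) false, List.length_replicate⟩

/-- Windows commute with XOR. [folklore] -/
theorem winL_zipWith (t : ℕ) (a b : List Bool) (ℓ : ℕ) :
    winL t (List.zipWith xor a b) ℓ = List.zipWith xor (winL t a ℓ) (winL t b ℓ) := by
  rw [winL, winL, winL, List.drop_zipWith, List.take_zipWith]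

/-- **The window of the XOR is zero iff the windows agree.** [folklore] -/
theorem win_xorV_eq_zeroWin_iff (z z' : List.Vector Bool (n + t)) (ℓ : Fin n) :
    win (xorV z z') ℓ = zeroWin t ↔ win z ℓ = win z' ℓ := by
  rw [← List.Vector.toList_injective.eq_iff, ← List.Vector.toList_injective.eq_iff]
  change winL t (List.zipWith xor z.toList z'.toList) ℓ = List.replicate (t + 1) false ↔
    winL t z.toList ℓ = winL t z'.toList ℓ
  have hlen : (winL t z.toList ℓ).length = t + 1 := length_winL (by rw [z.toList_length]; omega)
  have hlen' : (winL t z'.toList ℓ).length = t + 1 := length_winL (by rw [z'.toList_length]; omega)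
  rw [winL_zipWith, ← hlen, zipWith_xor_eq_replicate_iff _ _ (by rw [hlen, hlen'])]

variable (site : Fin r → Fin n)

/-- The number of **non-site zero windows** of a string. [cite: KumarSaraf2017, §8.5] -/
def nsZero (u : List.Vector Bool (n + t)) : ℕ :=
  ((nonSites site).filter fun ℓ => win u ℓ = zeroWin t).card

/-- **Agreement is the non-site zero-window count of the XOR.** [cite: KumarSaraf2017, §8.5] -/
theorem agr_eq_nsZero (z z' : List.Vector Bool (n + t)) : agr site z z' = nsZero site (xorV z z') := by
  unfold agr nsZero
  congr 1
  refine Finset.filter_congr fun ℓ _ => ?_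
  rw [win_xorV_eq_zeroWin_iff]

/-- XOR by a string with site windows `wv` maps `Zset wv` to `Zset 0`. [folklore] -/
theorem xorV_mem_Zset_zero {wv : Fin r → Win t} {z z' : List.Vector Bool (n + t)}
    (hz : z ∈ Zset site wv) (hz' : z' ∈ Zset site wv) : xorV z z' ∈ Zset site (fun _ => zeroWin t) := by
  rw [mem_Zset] at hz hz' ⊢
  intro i
  rw [win_xorV_eq_zeroWin_iff, hz i, hz' i]

/-- XOR by a string with site windows `wv` maps `Zset 0` to `Zset wv`. [folklore] -/
theorem xorV_mem_Zset {wv : Fin r → Win t} {z u : List.Vector Bool (n + t)}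
    (hz : z ∈ Zset site wv) (hu : u ∈ Zset site (fun _ => zeroWin t)) : xorV z u ∈ Zset site wv := by
  rw [mem_Zset] at hz hu ⊢
  intro i
  have h := hu i
  rw [← xorV_xorV z u, win_xorV_eq_zeroWin_iff] at h
  rw [← h, hz i]

/-- **Transport of the `T₂`-type sums**: for `z ∈ Zset wv`,
`∑_{z' ∈ Zset wv} f(agr(z, z')) = ∑_{u ∈ Zset 0} f(nsZero u)`. [cite: KumarSaraf2017, §8.5] -/
theorem sum_Zset_agr_eq {M : Type*} [AddCommMonoid M] (f : ℕ → M) {wv : Fin r → Win t}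
    {z : List.Vector Bool (n + t)} (hz : z ∈ Zset site wv) :
    ∑ z' ∈ Zset site wv, f (agr site z z') = ∑ u ∈ Zset site (fun _ => zeroWin t), f (nsZero site u) := by
  refine Finset.sum_nbij' (xorV z) (xorV z) (fun z' hz' => xorV_mem_Zset_zero site hz hz')
    (fun u hu => xorV_mem_Zset site hz hu) (fun z' _ => xorV_xorV z z') (fun u _ => xorV_xorV z u)
    (fun z' _ => ?_)
  rw [agr_eq_nsZero]

/-- **Transport of the `T₃`-type sums**: `∑_{z'} f(agr(z, z')) = ∑_u f(nsZero u)`.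
[cite: KumarSaraf2017, §8.5] -/
theorem sum_univ_agr_eq {M : Type*} [AddCommMonoid M] (f : ℕ → M) (z : List.Vector Bool (n + t)) :
    ∑ z', f (agr site z z') = ∑ u : List.Vector Bool (n + t), f (nsZero site u) := by
  refine Fintype.sum_equiv (Function.Involutive.toPerm (xorV z) (xorV_xorV z)) _ _ fun z' => ?_
  rw [agr_eq_nsZero]
  rfl

/-- The double sum over `(wv', z' ∈ Zset wv')` is the sum over all strings. [folklore] -/
theorem sum_sum_Zset_eq {M : Type*} [AddCommMonoid M] (f : List.Vector Bool (n + t) → M) :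
    ∑ wv : Fin r → Win t, ∑ z ∈ Zset site wv, f z = ∑ z, f z := by
  classical
  rw [← Finset.sum_fiberwise_of_maps_to (s := (Finset.univ : Finset (List.Vector Bool (n + t))))
    (t := (Finset.univ : Finset (Fin r → Win t))) (g := fun z => fun i => win z (site i))
    (fun _ _ => Finset.mem_univ _)]
  refine Finset.sum_congr rfl fun wv _ => ?_
  congr 1
  ext z
  simp [Zset, funext_iff]

/-! ### Zero windows as a count -/

/-- `take t u = 0^t` iff the leading run of `u` has length `≥ t`. [folklore] -/
theorem take_eq_replicate_iff_le_lead : ∀ (t : ℕ) (u : List Bool),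
    u.take t = List.replicate t false ↔ t ≤ lead u
  | 0, u => by simp
  | t + 1, [] => by simp
  | t + 1, true :: u => by rw [List.replicate_succ]; simp
  | t + 1, false :: u => by
    rw [List.take_succ_cons, List.replicate_succ, lead_cons_false]
    simp only [List.cons.injEq, true_and, take_eq_replicate_iff_le_lead t u]
    omega

/-- **`zwin` counts the all-zero windows**: `zwin t l = #{ℓ < |l| - t : l[ℓ..ℓ+t] = 0^{t+1}}`.
[folklore] -/
theorem zwin_eq_card (t : ℕ) : ∀ l : List Bool, zwin t l =
    ((Finset.range (l.length - t)).filter fun ℓ => winL t l ℓ = List.replicate (t + 1) false).card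
  | [] => by simp
  | b :: u => by
    have ih := zwin_eq_card t u
    rw [zwin_cons, ih, List.length_cons]
    rcases Nat.lt_or_ge u.length t with hlt | hge
    · -- too short for any window
      have h1 : u.length - t = 0 := by omega
      have h2 : u.length + 1 - t = 0 := by omega
      have h3 : ¬ (b = false ∧ t ≤ lead u) := fun h => by
        have := lead_le_length u; omega
      rw [h1, h2, if_neg h3]
      simp
    · rw [show u.length + 1 - t = (u.length - t) + 1 by omega, Finset.range_add_one',
        Finset.filter_insert, Finset.filter_map]
      -- position `0`
      have h0 : (winL t (b :: u) 0 = List.replicate (t + 1) false) ↔ (b = false ∧ t ≤ lead u) := by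
        rw [winL, List.drop_zero, List.take_succ_cons, List.replicate_succ, List.cons.injEq,
          take_eq_replicate_iff_le_lead]
      -- positions `ℓ + 1`
      have hs : ((Finset.range (u.length - t)).filter
          ((fun ℓ => winL t (b :: u) ℓ = List.replicate (t + 1) false) ∘
            (⟨fun i => i + 1, fun i j => by simp⟩ : ℕ ↪ ℕ))) =
          (Finset.range (u.length - t)).filter fun ℓ => winL t u ℓ = List.replicate (t + 1) false := by
        refine Finset.filter_congr fun ℓ _ => ?_
        simp [winL]
      rw [hs]
      by_cases hb : b = false ∧ t ≤ lead u
      · rw [if_pos hb, if_pos (h0.2 hb), Finset.card_insert_of_notMem (by simp), Finset.card_map,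
          add_comm]
      · rw [if_neg hb, if_neg (fun h => hb (h0.1 h)), Finset.card_map, add_zero]

/-- The count of zero windows of a string of length `n + t`, indexed by layers `ℓ < n`.
[folklore] -/
theorem zwin_toList_eq_card (u : List.Vector Bool (n + t)) :
    zwin t u.toList = (Finset.univ.filter fun ℓ : Fin n => win u ℓ = zeroWin t).card := by
  classical
  rw [zwin_eq_card, u.toList_length, Nat.add_sub_cancel]
  symm
  refine Finset.card_bij (fun ℓ _ => ℓ.val) (fun ℓ hℓ => ?_) (fun ℓ _ ℓ' _ h => Fin.ext h)
    (fun k hk => ?_)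
  · rw [Finset.mem_filter] at hℓ ⊢
    refine ⟨Finset.mem_range.2 ℓ.2, ?_⟩
    have h := congrArg List.Vector.toList hℓ.2
    exact h
  · rw [Finset.mem_filter, Finset.mem_range] at hk
    refine ⟨⟨k, hk.1⟩, Finset.mem_filter.2 ⟨Finset.mem_univ _, ?_⟩, rfl⟩
    apply List.Vector.eq
    exact hk.2

/-- Non-site zero windows are zero windows: `nsZero u ≤ zwin (u)`. [folklore] -/
theorem nsZero_le_zwin (u : List.Vector Bool (n + t)) : nsZero site u ≤ zwin t u.toList := by
  classical
  rw [zwin_toList_eq_card, nsZero]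
  exact Finset.card_le_card (Finset.filter_subset_filter _ (Finset.filter_subset _ _))

/-- **All zero windows = non-site zero windows + the `r` (zero) site windows** for a string
whose site windows vanish (`site` injective). [folklore] -/
theorem nsZero_add_eq_zwin (hsite : Function.Injective site) {u : List.Vector Bool (n + t)}
    (hu : u ∈ Zset site (fun _ => zeroWin t)) : nsZero site u + r = zwin t u.toList := by
  classical
  rw [zwin_toList_eq_card, nsZero]
  -- split the zero layers into non-sites and sites
  have hsplit : (Finset.univ.filter fun ℓ : Fin n => win u ℓ = zeroWin t) =
      ((nonSites site).filter fun ℓ => win u ℓ = zeroWin t) ∪ Finset.univ.image site := by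
    ext ℓ
    simp only [Finset.mem_filter, Finset.mem_univ, true_and, Finset.mem_union, mem_nonSites,
      Finset.mem_image]
    constructor
    · intro h
      by_cases hs : ∃ i, site i = ℓ
      · exact Or.inr hs
      · push Not at hs
        exact Or.inl ⟨hs, h⟩
    · rintro (⟨-, h⟩ | ⟨i, rfl⟩)
      · exact h
      · exact (mem_Zset.1 hu) i
  rw [hsplit, Finset.card_union_of_disjoint, Finset.card_image_of_injective _ hsite, Finset.card_univ,
    Fintype.card_fin]
  rw [Finset.disjoint_left]
  intro ℓ h1 h2
  rw [Finset.mem_filter, mem_nonSites] at h1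
  rw [Finset.mem_image] at h2
  obtain ⟨i, -, hi⟩ := h2
  exact h1.1 i hi

end SlidingWindow

end Literature.Computability.AlgebraicComplexity
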